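import Literature.IUT.HodgeArakelov.FlTorsorStructureConj
import Literature.IUT.HodgeArakelov.FlTorsorWreathToy
import Literature.IUT.HodgeArakelov.FlTorsorConjActKernel
import Literature.IUT.HodgeArakelov.CuspidalInertiaDataProfiniteOfCoverModel
import HarnessLib

/-!
# [IUTchII] Def 2.3 (v) — WITNESSES for the successor interface `FlTorsorStructureConj` (laws `conj_stable` +
# `conjAct_spec` of GAP-LEDGER G-w5d243-1): INHABITED on the wreath toy, EMPTY on the dihedral toy (which inhabits the
# typed `FlTorsorStructure`), law (a) at the tower of record `PlusMinusTower.ofPiCHat`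

S. Mochizuki, *Inter-universal Teichmüller theory II*, kurims manuscript (Dec. 2020), §2 Def 2.3 (ii) p. 68, (iii) p. 68,
(v) p. 69 («the natural action of `Π_⊇/Π_⊆` on `Π_⊆` preserves this `𝔽^±_l`-torsor structure, hence determines a natural
outer isomorphism `Π_⊇/Π_⊆ ≅ 𝔽_l^{⋊±}`»), Rmk 2.3.1 p. 69 [claim: Mochizuki2012, status: disputed] (IUTchII §2 Def 2.3 (v),
kurims p.69) (D-0012 claim key; record-only; nothing printed is asserted here).

abc-iut cell, seat abc-iut-w5-d243 gen 4 (companion of `FlTorsorStructureConj.lean`).  Three kernel facts about the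
STRENGTHENED Def 2.3 (v) interface (`FlTorsorStructureConj C`, `Def23_structuresConj Dec C`):

1. CONSISTENT — the wreath `𝔽_l^{⋊±}`-torsor toy (p433626; `Π̂^cor_v = (𝔽_l → D_3) ⋊ (D_l × ℤ/l)`, cusps = all conjugates of
   `⟨s⟩ ⊆ D_3` in one coordinate) INHABITS `FlTorsorStructureConj (wCusps …)` (`nonempty_flTorsorStructureConj`, by `ofIsConj genuine`: its
   `conjAct` IS conjugation, `genuine_isConj` by `rfl`) and `Def23_structuresConj` holds there for every `D`, `Dec`; closed instance
   `exists_def23_structuresConj` (`l = 3`, `p = 5`).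
2. INDEPENDENT of the typed interface — on the dihedral toy (p427711; `FlTorsorStructure` inhabited, `Def23_structures`
   holds) NO `FlTorsorStructure` satisfies law (b) (`FlTorsorToy.not_exists_conjAct_eq_conj`, p430806: the probe
   `g₀ ∉ Π̂^±_v` centralises every cusp but must move a label), so `FlTorsorStructureConj (fCusps …)` is EMPTY and
   `Def23_structuresConj` FAILS while `Def23_structures` HOLDS: closed separation `exists_def23_structures_not_conj`.  (So
   chart-read inhabitants of the typed interface — p427711, p419621's `FlTorsorStructure.nonempty_of_isos` — are correctly
   NOT producers of the successor; the Def 2.3 (v) NV census re-runs against `FlTorsorStructureConj`.)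
3. LAW (a) AT THE TOWER OF RECORD — abc-iut-w5-d132's p432649 (`PlusMinusTower.exists_cuspidalInertiaDataHat_ofPiCHat`:
   the profinite cuspidal datum of the genuine tower, `Π̂^±_v`-conjugates of the closures of the cusp family) restated in
   the successor's vocabulary: `∃ CuHat, … ∧ CuHat.ConjStable` (`PlusMinusTower.exists_conjStable_ofPiCHat`; the two
   spellings `MulAut.conj g • J` / `J.map (MulAut.conj g)` agree definitionally).  Law (b) there (a GENUINE
   `FlTorsorStructureConj` on `ofPiCHat`: `l` label classes of profinite cusps, conjugation acting affinely) is NOT in this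
   file — it is the natural next NV row.

HONEST LIMITS: 1 and 2 are finite discrete toys (`G_v = 1`), models of no tempered fundamental group; consistency ≠
faithfulness; typed ≠ proved; PROOF-ONLY (no `def`, no instance, no notation, no named fact); no side taken on [IUTchIII] Cor. 3.12;
nothing here asserts abc proved or refuted.
-/

noncomputable section

open scoped Pointwise

namespace Literature.IUT.HodgeArakelov

/-! ## 1. The wreath toy INHABITS the successor interface -/

namespace FlTorsorWreathToy

open DihedralGroup DihedralCuspToy FlTorsorToy CyclicToy Literature.IUT.HodgeTheaters

variable (l p : ℕ) (hl : l.Prime) (hl2 : l ≠ 2) (hp : p.Prime) (hp2 : p ≠ 2) (hpl : p ≠ l)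

/-- **Law (a) on the wreath toy**: the cusps of `Π̂^±_v` (all conjugates of the standard cusps) are permuted by
`Π̂^cor_v`-conjugation (`isCusp_conj`, p433626). [claim: Mochizuki2012, status: disputed] (IUTchII §2 Rmk 2.3.1, kurims p.69) -/
theorem conjStable : (wCusps l p hl hl2 hp hp2 hpl).ConjStable :=
  fun g _ hI => isCusp_conj l p hl hl2 hp hp2 hpl g hI

/-- **Law (b) on the wreath toy**: the genuine structure's `conjAct` IS conjugation (`conjAct_eq_conj`, by `rfl`).
[claim: Mochizuki2012, status: disputed] (IUTchII §2 Def 2.3 (v), kurims p.69) -/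
theorem genuine_isConj : (genuine l p hl hl2 hp hp2 hpl).IsConj :=
  fun _ _ _ _ => rfl

/-- The descended conjugation action `conjClass` of the successor file coincides with the toy's `conjAct`.
[claim: Mochizuki2012, status: disputed] (IUTchII §2 Def 2.3 (v), kurims p.69) -/
theorem conjClass_eq_conjAct :
    (conjStable l p hl hl2 hp hp2 hpl).conjClass = (genuine l p hl hl2 hp hp2 hpl).conjAct :=
  ((genuine_isConj l p hl hl2 hp hp2 hpl).conjAct_eq_conjClass (conjStable l p hl hl2 hp hp2 hpl)).symm

/-- The successor file's kernel theorem instantiated: on the wreath toy, `g` fixes every `±`-label class by conjugation iff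
`g ∈ Π̂^±_v = Ker(Wr ↠ D_l)`. [claim: Mochizuki2012, status: disputed] (IUTchII §2 Def 2.3 (v), kurims p.69) -/
theorem forall_conjClass_eq_self_iff (g : Wr l) :
    (∀ t, (conjStable l p hl hl2 hp hp2 hpl).conjClass g t = t) ↔ g ∈ (wTower l p hl hl2 hp hp2 hpl).pmHat :=
  (genuine_isConj l p hl hl2 hp hp2 hpl).forall_conjClass_eq_self_iff (conjStable l p hl hl2 hp hp2 hpl) g

/-- **`FlTorsorStructureConj C` is INHABITED on the wreath toy** — by `FlTorsorStructureConj.ofIsConj genuine …`, a structure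
whose label action is conjugation of cuspidal inertia subgroups: the successor interface of [IUTchII] Def 2.3 (v) is
consistent with every tower / cusp / label axiom. [claim: Mochizuki2012, status: disputed] (IUTchII §2 Def 2.3 (v), kurims p.69) -/
theorem nonempty_flTorsorStructureConj : Nonempty (FlTorsorStructureConj (wCusps l p hl hl2 hp hp2 hpl)) :=
  ⟨FlTorsorStructureConj.ofIsConj (genuine l p hl hl2 hp hp2 hpl) (conjStable l p hl hl2 hp hp2 hpl)
    (genuine_isConj l p hl hl2 hp hp2 hpl)⟩

/-- **The strengthened Def 2.3 (iii)–(v) existence predicate HOLDS on the wreath toy**, for every `D`, `Dec`.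
[claim: Mochizuki2012, status: disputed] (IUTchII §2 Def 2.3 (v), kurims p.69) -/
theorem def23_structuresConj
    {D : EtaleThetaData (wBadPlaceSetting l p hl hl2 hp hp2 hpl).toThetaSetting (wBadPlaceSetting l p hl hl2 hp hp2 hpl).PiX}
    (Dec : SubgraphDecomposition (wBadPlaceSetting l p hl hl2 hp hp2 hpl) (wCoverings l p hl hl2 hp hp2 hpl) D) :
    Def23_structuresConj Dec (wCusps l p hl hl2 hp hp2 hpl) :=
  (def23_structuresConj_iff Dec _).mpr
    ⟨def23_structures l p hl hl2 hp hp2 hpl Dec, conjStable l p hl hl2 hp hp2 hpl, _, genuine_isConj l p hl hl2 hp hp2 hpl⟩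

/-- **Closed instance** (`l := 3`, `p := 5`): there exist, in the kernel, `(S, T, D, Dec, W, C)` with
`Def23_structuresConj Dec C` — the successor interface is consistently inhabited jointly with every tower / cusp / label
axiom. [claim: Mochizuki2012, status: disputed] (IUTchII §2 Def 2.3 (v), kurims p.69) -/
theorem exists_def23_structuresConj :
    ∃ (S : BadPlaceSetting.{0}) (T : TemperedCoverings S S.PiX) (D : EtaleThetaData S.toThetaSetting S.PiX)
      (Dec : SubgraphDecomposition S T D) (W : PlusMinusTower T) (C : CuspidalInertiaData W),
      Def23_structuresConj Dec C ∧ Nonempty (FlTorsorStructureConj C) :=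
  ⟨wBadPlaceSetting 3 5 Nat.prime_three (by decide) Nat.prime_five (by decide) (by decide), _,
    degenerateEtaleThetaData _, degenerateDecomposition _ _ _, _, _,
    def23_structuresConj 3 5 Nat.prime_three (by decide) Nat.prime_five (by decide) (by decide) _,
    nonempty_flTorsorStructureConj 3 5 Nat.prime_three (by decide) Nat.prime_five (by decide) (by decide)⟩

end FlTorsorWreathToy

/-! ## 2. The dihedral toy does NOT inhabit the successor interface (though it inhabits the typed one) -/

namespace FlTorsorToy

open DihedralGroup DihedralCuspToy CyclicToy Literature.IUT.HodgeTheaters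

variable (l p : ℕ) (hl : l.Prime) (hl2 : l ≠ 2) (hp : p.Prime) (hp2 : p ≠ 2) (hpl : p ≠ l)

/-- **No typed structure on the dihedral toy satisfies law (b)** (`not_exists_conjAct_eq_conj`, p430806, read through
`IsConj`). [claim: Mochizuki2012, status: disputed] (IUTchII §2 Def 2.3 (v), kurims p.69) -/
theorem not_isConj (F : FlTorsorStructure (fCusps l p hl hl2 hp hp2 hpl)) : ¬ F.IsConj :=
  fun hF => not_exists_conjAct_eq_conj l p hl hl2 hp hp2 hpl ⟨F, hF⟩

/-- **The successor interface is EMPTY on the dihedral toy.** [claim: Mochizuki2012, status: disputed] (IUTchII §2 Def 2.3 (v), kurims p.69) -/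
theorem isEmpty_flTorsorStructureConj : IsEmpty (FlTorsorStructureConj (fCusps l p hl hl2 hp hp2 hpl)) :=
  ⟨fun F => not_isConj l p hl hl2 hp hp2 hpl F.toFlTorsorStructure F.isConj⟩

/-- … although the typed interface is inhabited there (p427711). [claim: Mochizuki2012, status: disputed] (IUTchII §2 Def 2.3 (v), kurims p.69) -/
theorem nonempty_and_isEmpty :
    Nonempty (FlTorsorStructure (fCusps l p hl hl2 hp hp2 hpl)) ∧
      IsEmpty (FlTorsorStructureConj (fCusps l p hl hl2 hp hp2 hpl)) :=
  ⟨nonempty_flTorsorStructure l p hl hl2 hp hp2 hpl, isEmpty_flTorsorStructureConj l p hl hl2 hp hp2 hpl⟩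

/-- **`Def23_structuresConj` FAILS on the dihedral toy** (for every `D`, `Dec`), while `Def23_structures` holds (p427711).
[claim: Mochizuki2012, status: disputed] (IUTchII §2 Def 2.3 (v), kurims p.69) -/
theorem not_def23_structuresConj
    {D : EtaleThetaData (dBadPlaceSetting l p hl hl2 hp hp2 hpl).toThetaSetting (dBadPlaceSetting l p hl hl2 hp hp2 hpl).PiX}
    (Dec : SubgraphDecomposition (dBadPlaceSetting l p hl hl2 hp hp2 hpl) (dCoverings l p hl hl2 hp hp2 hpl) D) :
    ¬ Def23_structuresConj Dec (fCusps l p hl hl2 hp hp2 hpl) :=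
  not_def23_structuresConj_of_forall_not_isConj Dec _ (not_isConj l p hl hl2 hp hp2 hpl)

/-- **Closed SEPARATION instance** (`l := 3`, `p := 5`): there exist, in the kernel, `(S, T, D, Dec, W, C)` with
`Def23_structures Dec C` TRUE and `Def23_structuresConj Dec C` FALSE — the successor predicate is strictly stronger than the
typed one (law (b) is independent of the typed axioms). [claim: Mochizuki2012, status: disputed] (IUTchII §2 Def 2.3 (v), kurims p.69) -/
theorem exists_def23_structures_not_conj :
    ∃ (S : BadPlaceSetting.{0}) (T : TemperedCoverings S S.PiX) (D : EtaleThetaData S.toThetaSetting S.PiX)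
      (Dec : SubgraphDecomposition S T D) (W : PlusMinusTower T) (C : CuspidalInertiaData W),
      Def23_structures Dec C ∧ ¬ Def23_structuresConj Dec C :=
  ⟨dBadPlaceSetting 3 5 Nat.prime_three (by decide) Nat.prime_five (by decide) (by decide),
    dCoverings 3 5 Nat.prime_three (by decide) Nat.prime_five (by decide) (by decide),
    degenerateEtaleThetaData _, degenerateDecomposition _ _ _,
    fTower 3 5 Nat.prime_three (by decide) Nat.prime_five (by decide) (by decide),
    fCusps 3 5 Nat.prime_three (by decide) Nat.prime_five (by decide) (by decide),
    def23_structures 3 5 Nat.prime_three (by decide) Nat.prime_five (by decide) (by decide) _,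
    not_def23_structuresConj 3 5 Nat.prime_three (by decide) Nat.prime_five (by decide) (by decide) _⟩

end FlTorsorToy

/-! ## 3. Law (a) at the tower of record `PlusMinusTower.ofPiCHat` (abc-iut-w5-d132, p432649) -/

namespace PlusMinusTower

open Literature.AnabelianGeometry.EtaleTheta Literature.AnabelianGeometry.SemiGraphs

variable {p : ℕ} [Fact p.Prime] {M : MuTwoSetting p} (e : M.CLevelData)
  {E : M.toThetaSetting.EtaleThetaData} {l : ℕ} (C : E.DoubleUnderline l) {N : ℕ+}
  (μ : M.toThetaSetting.CyclotomeMod l N) (hC : M.toThetaSetting.Compat) (hS : M.toThetaSetting.Sec2Hyps)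
  (hl : l.Prime) (hp2 : p ≠ 2) (hpl : p ≠ l) (hζ : ∃ ζ : M.toThetaSetting.K, IsPrimitiveRoot ζ (4 * l))
  {η : (C.thetaEnvData μ hC hS).PiYdd → MuN p N} (hη : η ∈ (C.thetaEnvData μ hC hS).thetaCocycles)
  (hZ : Thm16Sub.KerToZIsCompactlyGenerated M.toThetaSetting) (hN : (C.Huu.subgroupOf (M.GtpXu l)).Normal)
  {P : TopGroup.{0}} (T : TemperedCoverings (BadPlaceSetting.ofUnderline C μ hC hS hl hp2 hpl hζ hη) P)

/-- **Law (a) `ConjStable` HOLDS for the profinite cuspidal datum of the tower of record `ofPiCHat`** — the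
`Π̂^±_v`-conjugates of the closures of the cusp family (abc-iut-w5-d132's p432649, whose second conjunct IS `ConjStable` in
the pointwise spelling; modulo the tower's printed inputs `hZ`, `hN`). [claim: Mochizuki2012, status: disputed] (IUTchII §2 Rmk 2.3.1, kurims p.69) -/
theorem exists_conjStable_ofPiCHat :
    ∃ CuHat : CuspidalInertiaData (ofPiCHat e C μ hC hS hl hp2 hpl hζ hη hZ hN T),
      (∀ Q' J : Subgroup (ofPiCHat e C μ hC hS hl hp2 hpl hζ hη hZ hN T).Corhat,
        CuHat.IsCuspidalInertia Q' J ↔ J ≤ Q' ∧ ∃ i : {x : M.Pt // M.IsCusp x} × M.GtpC,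
          ∃ γ ∈ (ofPiCHat e C μ hC hS hl hp2 hpl hζ hη hZ hN T).pmHat,
            J = MulAut.conj γ •
              ((((MulAut.conj i.2 • (M.toTemperedCurve.inertia i.1.1).map M.inclX) ⊓ (M.GtpXu l).map M.inclX).map
                e.toPiCHat.toMonoidHom : Subgroup (ofPiCHat e C μ hC hS hl hp2 hpl hζ hη hZ hN T).Corhat)).topologicalClosure) ∧
      CuHat.ConjStable := by
  obtain ⟨CuHat, hchar, hstable⟩ := exists_cuspidalInertiaDataHat_ofPiCHat e C μ hC hS hl hp2 hpl hζ hη hZ hN T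
  exact ⟨CuHat, hchar, (CuspidalInertiaData.conjStable_iff_smul).mpr hstable⟩

end PlusMinusTower

/-! ## 4. Consumers: abc-iut-w4-d004's [IUTchII] Cor 3.5 (i) label clauses, now for GENUINE conjugation -/

namespace FlTorsorStructureConj

open Literature.IUT.HodgeTheaters

universe u

variable {S : BadPlaceSetting.{u}} {P : TopGroup.{u}} {T : TemperedCoverings S P} {W : PlusMinusTower T}
  {C : CuspidalInertiaData W} (F : FlTorsorStructureConj C)

/-- **IUTchII:Cor3.5(i)** (kurims p. 94), `𝔽_l^{⋊±}`-symmetry read for GENUINE conjugation: `Π̂^cor_v`-CONJUGATION is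
TRANSITIVE on the `±`-label classes of cusps of `Π̂^±_v` — any two cuspidal inertia subgroups of `Π̂^±_v` have
`Π̂^cor_v`-conjugates in the same label class (abc-iut-w4-d004's `BadPrimeGaussianMonoids.exists_conjAct_eq` along law (b)).
[claim: Mochizuki2012, status: disputed] (IUTchII §3 Cor 3.5 (i), kurims p.94) -/
theorem exists_conjClass_eq (t t' : LabCuspPM C W.pmHat W.pmHat) :
    ∃ g : W.Corhat, F.conj_stable.conjClass g t = t' := by
  simpa only [F.conjAct_eq_conjClass] using BadPrimeGaussianMonoids.exists_conjAct_eq F.toFlTorsorStructure t t'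

/-- **IUTchII:Cor3.5(i)** (kurims p. 94): `g ∈ Π̂^cor_v` FIXES the label class `t` BY CONJUGATION iff its image in
`𝔽_l^{⋊±}` is the identity or the reflection `x ↦ -x + 2·chart t` (w4-d004's `conjAct_eq_self_iff` along law (b)).
[claim: Mochizuki2012, status: disputed] (IUTchII §3 Cor 3.5 (i), kurims p.94) -/
theorem conjClass_eq_self_iff (g : W.Corhat) (t : LabCuspPM C W.pmHat W.pmHat) :
    F.conj_stable.conjClass g t = t ↔
      F.quotIso (QuotientGroup.mk g) = 1 ∨ F.quotIso (QuotientGroup.mk g) = FlPM.mk (2 * F.chart t) (-1) := by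
  rw [← F.conjAct_eq_conjClass]
  exact BadPrimeGaussianMonoids.conjAct_eq_self_iff F.toFlTorsorStructure g t

/-- **IUTchII:Cor3.5(i)** (kurims p. 94): some `g ∈ Π̂^cor_v` CONJUGATES every label class `t` to the class `-t`
(w4-d004's `exists_conjAct_neg` along law (b)). [claim: Mochizuki2012, status: disputed] (IUTchII §3 Cor 3.5 (i), kurims p.94) -/
theorem exists_conjClass_neg :
    ∃ g : W.Corhat, ∀ t : LabCuspPM C W.pmHat W.pmHat, F.chart (F.conj_stable.conjClass g t) = -F.chart t := by
  simpa only [F.conjAct_eq_conjClass] using BadPrimeGaussianMonoids.exists_conjAct_neg F.toFlTorsorStructure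

end FlTorsorStructureConj

end Literature.IUT.HodgeArakelov

end
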